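import Summits.FinalStateConjecture.FinalStateConjecture.Theorems.ZeroEnergyKerrOrBombFinalStateFromKerrOrBombKerrAsymptoticRigidity
import Summits.FinalStateConjecture.FinalStateConjecture.Theorems.ZeroEnergyKerrOrBombFinalStateFromKerrOrBombKerrAsymptoticRigidityShells
import Summits.FinalStateConjecture.FinalStateConjecture.Theorems.ZeroEnergyKerrOrBombFinalStateFromKerrOrBombKerrAsymptoticRigidityD2
import Summits.FinalStateConjecture.FinalStateConjecture.Theorems.ZeroEnergyKerrOrBombFinalStateFromKerrOrBombKerrAsymptoticRigidityRadii
import Summits.FinalStateConjecture.FinalStateConjecture.Theorems.ZeroEnergyKerrOrBombFinalStateFromKerrOrBombKerrAsymptoticRigidityD2Decay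
import Summits.FinalStateConjecture.FinalStateConjecture.Theorems.ZeroEnergyKerrOrBombFinalStateFromKerrOrBombKerrAsymptoticRigidityLimit
import Summits.FinalStateConjecture.FinalStateConjecture.Theorems.ZeroEnergyKerrOrBombFinalStateFromKerrOrBombKerrAsymptoticRigidityDrift
import Summits.FinalStateConjecture.FinalStateConjecture.Theorems.ZeroEnergyKerrOrBombFinalStateFromKerrOrBombKerrAsymptoticRigidityMass
import Summits.FinalStateConjecture.FinalStateConjecture.Theorems.ZeroEnergyKerrOrBombFinalStateFromKerrOrBombKerrAsymptoticRigidityTiltDeriv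
import Summits.FinalStateConjecture.FinalStateConjecture.Theorems.ZeroEnergyKerrOrBombFinalStateFromKerrOrBombKerrAsymptoticRigidityTilt
import Summits.FinalStateConjecture.FinalStateConjecture.Theorems.ZeroEnergyKerrOrBombFinalStateFromKerrOrBombKerrAsymptoticRigidityD3
import HarnessLib

/-!
# Route ZeroEnergyKerrOrBomb · crux `FinalStateFromKerrOrBomb` (stmt-FinalStateConjecture-17839), line `SketchIdeator1` —
# stub `stub_kerrAsymptoticRigidity` (F4 of stub 1R): the CLOSER `kerrAsymptoticRigidity_holds`

Helper file (`--supports stmt-FinalStateConjecture-17839`; registered closer `kerrAsymptoticRigidity_holds : KerrAsymptoticRigidity`)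
of the lead's wave-3 stub-worker W12 (2026-08-17). It imports the thirteen F4 layer modules, repeats the pure-logic assembly
`kerrAsymptoticRigidity_of_layers : (L1) → (L2) → ⋯ → (L13) → KerrAsymptoticRigidity`, where `L1 … L13` are, verbatim
and in this order, the statements of the thirteen F4 layer theorems `kerrAsymptoticRigidity_c_eq_one` (1),
`…_fderiv_bounded` (2), `…_of_far` (3), `…_iteratedFDeriv_two_le` (4), `…_iteratedFDeriv_two_bounded` (5),
`…_radius_comparable` (6), `…_iteratedFDeriv_two_decay` (7), `…_fderiv_limit` (8), `…_drift` (9), `…_mass_and_radius` (10),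
`…_tilt_fderiv` (11), `…_tilt_bounded` (12), `…_iteratedFDeriv_three_bounded` (13). Each layer takes the binder list of
`KerrAsymptoticRigidity` verbatim and the conclusions of earlier layers as hypotheses; the assembly feeds the common
hypotheses to every layer, threads the existential witnesses in the order 1, 2, 4, 5, 6, 7, 8, 9, 10, 11, 12, 13, and closes
with layer 3 (`of_far`) at the maximum of the thresholds and of the bounds, using `‖iteratedFDeriv ℝ 1 Θ u‖ = ‖fderiv ℝ Θ u‖`.
No analysis, nothing restated, no named fact consumed; the closer `kerrAsymptoticRigidity_holds` applies the assembly to the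
thirteen landed layer theorems.
References: Chruściel–Costa arXiv:0806.0016, §2.1; Bartnik, CPAM 39 (1986), §3 Cor. 3.2.
-/

set_option linter.dupNamespace false
-- the operator norm on `E4 →L[ℝ] E4 →L[ℝ] E4 →L[ℝ] ℝ` (`‖fderiv ℝ (Kerr.bilin M a) u‖`, layer 4) needs one more pending level
set_option maxSynthPendingDepth 3

noncomputable section

open scoped Manifold ContDiff Topology RealInnerProductSpace
open Set Filter Function Bornology

namespace Summit.FinalStateConjecture.FinalStateConjecture.Theorems.SymplecticDualOfTheBomb

open Literature.Geometry.Lorentzian Summit.FinalStateConjecture.FinalStateConjecture.Theorems.OneLockedExplosion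

/-- **Assembly of F4 from its thirteen layers** (pure logic). Given the thirteen layer statements `L1 … L13` as
hypotheses (in the order `c_eq_one`, `fderiv_bounded`, `of_far`, `iteratedFDeriv_two_le`, `iteratedFDeriv_two_bounded`,
`radius_comparable`, `iteratedFDeriv_two_decay`, `fderiv_limit`, `drift`, `mass_and_radius`, `tilt_fderiv`, `tilt_bounded`,
`iteratedFDeriv_three_bounded`), `KerrAsymptoticRigidity` follows: feed the common binders to each layer, thread the
witnesses `R, L` (2), `R'` (4), `R', L₂` (5), `R', C` (6), `R₅, C₅` (7), `Λ, R₆, C₆` (8), `R₇, C₇` (9), mass clause and `R₈, L₈`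
(10), `R₉, C₉` (11), tilt bound (12), third-derivative bound (13), and close with layer 3 at the maximum of the thresholds
and bounds (`‖iteratedFDeriv ℝ 1 Θ u‖ = ‖fderiv ℝ Θ u‖`, `interval_cases` on `1 ≤ n ≤ 3`). [folklore] -/
theorem kerrAsymptoticRigidity_of_layers : (∀ (𝓑 : StationaryAFBlackHole.{0}) (A : 𝓑.AdaptedChart) (M a c : ℝ) (Θ : E4 → E4), ChartIsAsymptoticallyCartesian A → ChartIsAsymptoticallySchwarzschildean' A → Kerr.IsSubextremal M a → 0 < c → ContDiffOn ℝ ∞ Θ (Kerr.exterior M a : Set E4) → Set.InjOn Θ (Kerr.exterior M a : Set E4) → Set.MapsTo Θ (Kerr.exterior M a : Set E4) (A.domain : Set E4) → (∀ x ∈ (Kerr.exterior M a : Set E4), ∀ s : ℝ, Θ (x + s • E4.basisVector 0) = Θ x + (c * s) • E4.basisVector 0) → (∀ x ∈ (Kerr.exterior M a : Set E4), ∀ v w : E4, A.bilin (Θ x) (fderiv ℝ Θ x v) (fderiv ℝ Θ x w) = Kerr.bilin M a x v w) → Θ '' (Kerr.exterior M a : Set E4) = {u : E4 | ∃ h : u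 ∈ A.domain, A.toFun ⟨u, h⟩ ∈ 𝓑.doc} → (∀ R₁ : ℝ, ∃ R : ℝ, ∀ x ∈ (Kerr.exterior M a : Set E4), R ≤ Kerr.radius a x → R₁ ≤ A.radius (Θ x)) → c = 1) → (∀ (𝓑 : StationaryAFBlackHole.{0}) (A : 𝓑.AdaptedChart) (M a c : ℝ) (Θ : E4 → E4), ChartIsAsymptoticallyCartesian A → ChartIsAsymptoticallySchwarzschildean' A → Kerr.IsSubextremal M a → 0 < c → ContDiffOn ℝ ∞ Θ (Kerr.exterior M a : Set E4) → Set.InjOn Θ (Kerr.exterior M a : Set E4) → Set.MapsTo Θ (Kerr.exterior M a : Set E4) (A.domain : Set E4) → (∀ x ∈ (Kerr.exterior M a : Set E4), ∀ s : ℝ, Θ (x + s • E4.basisVector 0) = Θ x + (c * s) • E4.basisVector 0) → (∀ x ∈ (Kerr.exterior M a : Set E4), ∀ v w : E4, A.bilin (Θ x) (fderiv ℝ Θ x v) (fderiv ℝ Θ x w) = Kerr.bilin M a x v w) → Θ '' (Kerr.exterior M a : Set E4) = {u : E4 | ∃ h : u ∈ A.domain, A.toFun ⟨u, h⟩ ∈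 𝓑.doc} → (∀ R₁ : ℝ, ∃ R : ℝ, ∀ x ∈ (Kerr.exterior M a : Set E4), R ≤ Kerr.radius a x → R₁ ≤ A.radius (Θ x)) → ∃ R L : ℝ, ∀ u ∈ (Kerr.exterior M a : Set E4), R ≤ Kerr.radius a u → ‖fderiv ℝ Θ u‖ ≤ L ∧ ∀ v : E4, ‖v‖ ≤ L * ‖fderiv ℝ Θ u v‖) → (∀ (𝓑 : StationaryAFBlackHole.{0}) (A : 𝓑.AdaptedChart) (M a c : ℝ) (Θ : E4 → E4), ChartIsAsymptoticallyCartesian A → ChartIsAsymptoticallySchwarzschildean' A → Kerr.IsSubextremal M a → 0 < c → ContDiffOn ℝ ∞ Θ (Kerr.exterior M a : Set E4) → Set.InjOn Θ (Kerr.exterior M a : Set E4) → Set.MapsTo Θ (Kerr.exterior M a : Set E4) (A.domain : Set E4) → (∀ x ∈ (Kerr.exterior M a : Set E4), ∀ s : ℝ, Θ (x + s • E4.basisVector 0) = Θ x + (c * s) • E4.basisVector 0) → (∀ x ∈ (Kerr.exterior M a : Set E4), ∀ v w : E4, A.bilin (Θ x) (fderiv ℝ Θ x v) (fderiv ℝ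 Θ x w) = Kerr.bilin M a x v w) → Θ '' (Kerr.exterior M a : Set E4) = {u : E4 | ∃ h : u ∈ A.domain, A.toFun ⟨u, h⟩ ∈ 𝓑.doc} → (∀ R₁ : ℝ, ∃ R : ℝ, ∀ x ∈ (Kerr.exterior M a : Set E4), R ≤ Kerr.radius a x → R₁ ≤ A.radius (Θ x)) → (∃ R L₀ : ℝ, ∀ u ∈ (Kerr.exterior M a : Set E4), R ≤ Kerr.radius a u → |Θ u 0 - c * u 0| ≤ L₀ ∧ |A.radius (Θ u) - Kerr.radius a u| ≤ L₀ ∧ ∀ n : ℕ, 1 ≤ n → n ≤ 3 → ‖iteratedFDeriv ℝ n Θ u‖ ≤ L₀) → ∃ L : ℝ, ∀ u ∈ (Kerr.exterior M a : Set E4), Kerr.rPlus M a + 1 ≤ Kerr.radius a u → |Θ u 0 - c * u 0| ≤ L ∧ |A.radius (Θ u) - Kerr.radius a u| ≤ L ∧ ∀ n : ℕ, 1 ≤ n → n ≤ 3 → ‖iteratedFDeriv ℝ n Θ u‖ ≤ L) → (∀ (𝓑 : StationaryAFBlackHole.{0}) (A : 𝓑.AdaptedChart) (M a c : ℝ) (Θ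 : E4 → E4), ChartIsAsymptoticallyCartesian A → ChartIsAsymptoticallySchwarzschildean' A → Kerr.IsSubextremal M a → 0 < c → ContDiffOn ℝ ∞ Θ (Kerr.exterior M a : Set E4) → Set.InjOn Θ (Kerr.exterior M a : Set E4) → Set.MapsTo Θ (Kerr.exterior M a : Set E4) (A.domain : Set E4) → (∀ x ∈ (Kerr.exterior M a : Set E4), ∀ s : ℝ, Θ (x + s • E4.basisVector 0) = Θ x + (c * s) • E4.basisVector 0) → (∀ x ∈ (Kerr.exterior M a : Set E4), ∀ v w : E4, A.bilin (Θ x) (fderiv ℝ Θ x v) (fderiv ℝ Θ x w) = Kerr.bilin M a x v w) → Θ '' (Kerr.exterior M a : Set E4) = {u : E4 | ∃ h : u ∈ A.domain, A.toFun ⟨u, h⟩ ∈ 𝓑.doc} → (∀ R₁ : ℝ, ∃ R : ℝ, ∀ x ∈ (Kerr.exterior M a : Set E4), R ≤ Kerr.radius a x → R₁ ≤ A.radius (Θ x)) → ∀ R L : ℝ, (∀ u ∈ (Kerr.exterior M a : Set E4), R ≤ Kerr.radius a u → ‖fderiv ℝ Θ u‖ ≤ L ∧ ∀ v : E4, ‖v‖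 ≤ L * ‖fderiv ℝ Θ u v‖) → ∃ R' : ℝ, ∀ u ∈ (Kerr.exterior M a : Set E4), R' ≤ Kerr.radius a u → ‖iteratedFDeriv ℝ 2 Θ u‖ ≤ 2 * L * (‖fderiv ℝ (Kerr.bilin M a) u‖ + L ^ 3 * ‖fderiv ℝ A.bilin (Θ u)‖)) → (∀ (𝓑 : StationaryAFBlackHole.{0}) (A : 𝓑.AdaptedChart) (M a c : ℝ) (Θ : E4 → E4), ChartIsAsymptoticallyCartesian A → ChartIsAsymptoticallySchwarzschildean' A → Kerr.IsSubextremal M a → 0 < c → ContDiffOn ℝ ∞ Θ (Kerr.exterior M a : Set E4) → Set.InjOn Θ (Kerr.exterior M a : Set E4) → Set.MapsTo Θ (Kerr.exterior M a : Set E4) (A.domain : Set E4) → (∀ x ∈ (Kerr.exterior M a : Set E4), ∀ s : ℝ, Θ (x + s • E4.basisVector 0) = Θ x + (c * s) • E4.basisVector 0) → (∀ x ∈ (Kerr.exterior M a : Set E4), ∀ v w : E4, A.bilin (Θ x) (fderiv ℝ Θ x v) (fderiv ℝ Θ x w) = Kerr.bilin M a x v w) → Θ '' (Kerr.exterior M a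 : Set E4) = {u : E4 | ∃ h : u ∈ A.domain, A.toFun ⟨u, h⟩ ∈ 𝓑.doc} → (∀ R₁ : ℝ, ∃ R : ℝ, ∀ x ∈ (Kerr.exterior M a : Set E4), R ≤ Kerr.radius a x → R₁ ≤ A.radius (Θ x)) → ∀ R L : ℝ, (∀ u ∈ (Kerr.exterior M a : Set E4), R ≤ Kerr.radius a u → ‖fderiv ℝ Θ u‖ ≤ L ∧ ∀ v : E4, ‖v‖ ≤ L * ‖fderiv ℝ Θ u v‖) → ∃ R' L₂ : ℝ, ∀ u ∈ (Kerr.exterior M a : Set E4), R' ≤ Kerr.radius a u → ‖iteratedFDeriv ℝ 2 Θ u‖ ≤ L₂) → (∀ (𝓑 : StationaryAFBlackHole.{0}) (A : 𝓑.AdaptedChart) (M a c : ℝ) (Θ : E4 → E4), ChartIsAsymptoticallyCartesian A → ChartIsAsymptoticallySchwarzschildean' A → Kerr.IsSubextremal M a → 0 < c → ContDiffOn ℝ ∞ Θ (Kerr.exterior M a : Set E4) → Set.InjOn Θ (Kerr.exterior M a : Set E4) → Set.MapsTo Θ (Kerr.exterior M a : Set E4) (A.domain : Set E4) → (∀ x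 ∈ (Kerr.exterior M a : Set E4), ∀ s : ℝ, Θ (x + s • E4.basisVector 0) = Θ x + (c * s) • E4.basisVector 0) → (∀ x ∈ (Kerr.exterior M a : Set E4), ∀ v w : E4, A.bilin (Θ x) (fderiv ℝ Θ x v) (fderiv ℝ Θ x w) = Kerr.bilin M a x v w) → Θ '' (Kerr.exterior M a : Set E4) = {u : E4 | ∃ h : u ∈ A.domain, A.toFun ⟨u, h⟩ ∈ 𝓑.doc} → (∀ R₁ : ℝ, ∃ R : ℝ, ∀ x ∈ (Kerr.exterior M a : Set E4), R ≤ Kerr.radius a x → R₁ ≤ A.radius (Θ x)) → c = 1 → ∀ R L : ℝ, (∀ u ∈ (Kerr.exterior M a : Set E4), R ≤ Kerr.radius a u → ‖fderiv ℝ Θ u‖ ≤ L ∧ ∀ v : E4, ‖v‖ ≤ L * ‖fderiv ℝ Θ u v‖) → ∃ R' C : ℝ, ∀ x ∈ (Kerr.exterior M a : Set E4), R' ≤ Kerr.radius a x → Kerr.radius a x ≤ C * A.radius (Θ x) ∧ A.radius (Θ x) ≤ C * Kerr.radius a x) → (∀ (𝓑 : StationaryAFBlackHole.{0}) (A : 𝓑.AdaptedChart)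 (M a c : ℝ) (Θ : E4 → E4), ChartIsAsymptoticallyCartesian A → ChartIsAsymptoticallySchwarzschildean' A → Kerr.IsSubextremal M a → 0 < c → ContDiffOn ℝ ∞ Θ (Kerr.exterior M a : Set E4) → Set.InjOn Θ (Kerr.exterior M a : Set E4) → Set.MapsTo Θ (Kerr.exterior M a : Set E4) (A.domain : Set E4) → (∀ x ∈ (Kerr.exterior M a : Set E4), ∀ s : ℝ, Θ (x + s • E4.basisVector 0) = Θ x + (c * s) • E4.basisVector 0) → (∀ x ∈ (Kerr.exterior M a : Set E4), ∀ v w : E4, A.bilin (Θ x) (fderiv ℝ Θ x v) (fderiv ℝ Θ x w) = Kerr.bilin M a x v w) → Θ '' (Kerr.exterior M a : Set E4) = {u : E4 | ∃ h : u ∈ A.domain, A.toFun ⟨u, h⟩ ∈ 𝓑.doc} → (∀ R₁ : ℝ, ∃ R : ℝ, ∀ x ∈ (Kerr.exterior M a : Set E4), R ≤ Kerr.radius a x → R₁ ≤ A.radius (Θ x)) → ∀ R L : ℝ, (∀ u ∈ (Kerr.exterior M a : Set E4), R ≤ Kerr.radius a u → ‖fderiv ℝ Θ u‖ ≤ L ∧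 ∀ v : E4, ‖v‖ ≤ L * ‖fderiv ℝ Θ u v‖) → (∃ R' : ℝ, ∀ u ∈ (Kerr.exterior M a : Set E4), R' ≤ Kerr.radius a u → ‖iteratedFDeriv ℝ 2 Θ u‖ ≤ 2 * L * (‖fderiv ℝ (Kerr.bilin M a) u‖ + L ^ 3 * ‖fderiv ℝ A.bilin (Θ u)‖)) → (∃ R' C : ℝ, ∀ x ∈ (Kerr.exterior M a : Set E4), R' ≤ Kerr.radius a x → Kerr.radius a x ≤ C * A.radius (Θ x) ∧ A.radius (Θ x) ≤ C * Kerr.radius a x) → ∃ R₅ C₅ : ℝ, ∀ u ∈ (Kerr.exterior M a : Set E4), R₅ ≤ Kerr.radius a u → ‖iteratedFDeriv ℝ 2 Θ u‖ ≤ C₅ / Kerr.radius a u ^ 2) → (∀ (𝓑 : StationaryAFBlackHole.{0}) (A : 𝓑.AdaptedChart) (M a c : ℝ) (Θ : E4 → E4), ChartIsAsymptoticallyCartesian A → ChartIsAsymptoticallySchwarzschildean' A → Kerr.IsSubextremal M a → 0 < c → ContDiffOn ℝ ∞ Θ (Kerr.exterior M a : Set E4) → Set.InjOn Θ (Kerr.exterior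 M a : Set E4) → Set.MapsTo Θ (Kerr.exterior M a : Set E4) (A.domain : Set E4) → (∀ x ∈ (Kerr.exterior M a : Set E4), ∀ s : ℝ, Θ (x + s • E4.basisVector 0) = Θ x + (c * s) • E4.basisVector 0) → (∀ x ∈ (Kerr.exterior M a : Set E4), ∀ v w : E4, A.bilin (Θ x) (fderiv ℝ Θ x v) (fderiv ℝ Θ x w) = Kerr.bilin M a x v w) → Θ '' (Kerr.exterior M a : Set E4) = {u : E4 | ∃ h : u ∈ A.domain, A.toFun ⟨u, h⟩ ∈ 𝓑.doc} → (∀ R₁ : ℝ, ∃ R : ℝ, ∀ x ∈ (Kerr.exterior M a : Set E4), R ≤ Kerr.radius a x → R₁ ≤ A.radius (Θ x)) → (∃ R₅ C₅ : ℝ, ∀ u ∈ (Kerr.exterior M a : Set E4), R₅ ≤ Kerr.radius a u → ‖iteratedFDeriv ℝ 2 Θ u‖ ≤ C₅ / Kerr.radius a u ^ 2) → ∃ Λ : E4 →L[ℝ] E4, Λ (E4.basisVector 0) = c • E4.basisVector 0 ∧ (∀ v w : E4, Minkowski.bilin (Λ v) (Λ w) = Minkowski.bilin v w) ∧ ∃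 R₆ C₆ : ℝ, ∀ x ∈ (Kerr.exterior M a : Set E4), R₆ ≤ Kerr.radius a x → ‖fderiv ℝ Θ x - Λ‖ ≤ C₆ / Kerr.radius a x) → (∀ (𝓑 : StationaryAFBlackHole.{0}) (A : 𝓑.AdaptedChart) (M a c : ℝ) (Θ : E4 → E4), ChartIsAsymptoticallyCartesian A → ChartIsAsymptoticallySchwarzschildean' A → Kerr.IsSubextremal M a → 0 < c → ContDiffOn ℝ ∞ Θ (Kerr.exterior M a : Set E4) → Set.InjOn Θ (Kerr.exterior M a : Set E4) → Set.MapsTo Θ (Kerr.exterior M a : Set E4) (A.domain : Set E4) → (∀ x ∈ (Kerr.exterior M a : Set E4), ∀ s : ℝ, Θ (x + s • E4.basisVector 0) = Θ x + (c * s) • E4.basisVector 0) → (∀ x ∈ (Kerr.exterior M a : Set E4), ∀ v w : E4, A.bilin (Θ x) (fderiv ℝ Θ x v) (fderiv ℝ Θ x w) = Kerr.bilin M a x v w) → Θ '' (Kerr.exterior M a : Set E4) = {u : E4 | ∃ h : u ∈ A.domain, A.toFun ⟨u, h⟩ ∈ 𝓑.doc} → (∀ R₁ : ℝ, ∃ R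 : ℝ, ∀ x ∈ (Kerr.exterior M a : Set E4), R ≤ Kerr.radius a x → R₁ ≤ A.radius (Θ x)) → ∀ (Λ : E4 →L[ℝ] E4) (R₆ C₆ : ℝ), Λ (E4.basisVector 0) = c • E4.basisVector 0 → (∀ x ∈ (Kerr.exterior M a : Set E4), R₆ ≤ Kerr.radius a x → ‖fderiv ℝ Θ x - Λ‖ ≤ C₆ / Kerr.radius a x) → ∃ R₇ C₇ : ℝ, ∀ x ∈ (Kerr.exterior M a : Set E4), R₇ ≤ Kerr.radius a x → ‖Θ x - Λ x‖ ≤ C₇ * Real.sqrt (Kerr.radius a x)) → (∀ (𝓑 : StationaryAFBlackHole.{0}) (A : 𝓑.AdaptedChart) (M a c : ℝ) (Θ : E4 → E4), ChartIsAsymptoticallyCartesian A → ChartIsAsymptoticallySchwarzschildean' A → Kerr.IsSubextremal M a → 0 < c → ContDiffOn ℝ ∞ Θ (Kerr.exterior M a : Set E4) → Set.InjOn Θ (Kerr.exterior M a : Set E4) → Set.MapsTo Θ (Kerr.exterior M a : Set E4) (A.domain : Set E4) → (∀ x ∈ (Kerr.exterior M a : Set E4), ∀ s : ℝ, Θ (x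 + s • E4.basisVector 0) = Θ x + (c * s) • E4.basisVector 0) → (∀ x ∈ (Kerr.exterior M a : Set E4), ∀ v w : E4, A.bilin (Θ x) (fderiv ℝ Θ x v) (fderiv ℝ Θ x w) = Kerr.bilin M a x v w) → Θ '' (Kerr.exterior M a : Set E4) = {u : E4 | ∃ h : u ∈ A.domain, A.toFun ⟨u, h⟩ ∈ 𝓑.doc} → (∀ R₁ : ℝ, ∃ R : ℝ, ∀ x ∈ (Kerr.exterior M a : Set E4), R ≤ Kerr.radius a x → R₁ ≤ A.radius (Θ x)) → c = 1 → ∀ (Λ : E4 →L[ℝ] E4) (R₇ C₇ : ℝ), Λ (E4.basisVector 0) = c • E4.basisVector 0 → (∀ v w : E4, Minkowski.bilin (Λ v) (Λ w) = Minkowski.bilin v w) → (∀ x ∈ (Kerr.exterior M a : Set E4), R₇ ≤ Kerr.radius a x → ‖Θ x - Λ x‖ ≤ C₇ * Real.sqrt (Kerr.radius a x)) → (∃ R' C : ℝ, ∀ x ∈ (Kerr.exterior M a : Set E4), R' ≤ Kerr.radius a x → Kerr.radius a x ≤ C * A.radius (Θ x) ∧ A.radius (Θ x) ≤ C * Kerr.radius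 a x) → (∃ C R₀ : ℝ, ∀ x : A.domain, R₀ ≤ A.radius x.1 → ∀ n : ℕ, n ≤ 2 → ‖iteratedFDeriv ℝ n (fun y ↦ A.bilin y - Kerr.bilin M 0 y) x.1‖ ≤ C / (A.radius x.1) ^ (n + 2)) ∧ ∃ R₈ L₈ : ℝ, ∀ x ∈ (Kerr.exterior M a : Set E4), R₈ ≤ Kerr.radius a x → |A.radius (Θ x) - Kerr.radius a x| ≤ L₈) → (∀ (𝓑 : StationaryAFBlackHole.{0}) (A : 𝓑.AdaptedChart) (M a c : ℝ) (Θ : E4 → E4), ChartIsAsymptoticallyCartesian A → ChartIsAsymptoticallySchwarzschildean' A → Kerr.IsSubextremal M a → 0 < c → ContDiffOn ℝ ∞ Θ (Kerr.exterior M a : Set E4) → Set.InjOn Θ (Kerr.exterior M a : Set E4) → Set.MapsTo Θ (Kerr.exterior M a : Set E4) (A.domain : Set E4) → (∀ x ∈ (Kerr.exterior M a : Set E4), ∀ s : ℝ, Θ (x + s • E4.basisVector 0) = Θ x + (c * s) • E4.basisVector 0) → (∀ x ∈ (Kerr.exterior M a : Set E4), ∀ v w : E4, A.bilin (Θ x)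 (fderiv ℝ Θ x v) (fderiv ℝ Θ x w) = Kerr.bilin M a x v w) → Θ '' (Kerr.exterior M a : Set E4) = {u : E4 | ∃ h : u ∈ A.domain, A.toFun ⟨u, h⟩ ∈ 𝓑.doc} → (∀ R₁ : ℝ, ∃ R : ℝ, ∀ x ∈ (Kerr.exterior M a : Set E4), R ≤ Kerr.radius a x → R₁ ≤ A.radius (Θ x)) → c = 1 → ∀ (Λ : E4 →L[ℝ] E4) (R₆ C₆ R₇ C₇ : ℝ), Λ (E4.basisVector 0) = c • E4.basisVector 0 → (∀ v w : E4, Minkowski.bilin (Λ v) (Λ w) = Minkowski.bilin v w) → (∀ x ∈ (Kerr.exterior M a : Set E4), R₆ ≤ Kerr.radius a x → ‖fderiv ℝ Θ x - Λ‖ ≤ C₆ / Kerr.radius a x) → (∀ x ∈ (Kerr.exterior M a : Set E4), R₇ ≤ Kerr.radius a x → ‖Θ x - Λ x‖ ≤ C₇ * Real.sqrt (Kerr.radius a x)) → (∃ C R₀ : ℝ, ∀ x : A.domain, R₀ ≤ A.radius x.1 → ∀ n : ℕ, n ≤ 2 → ‖iteratedFDeriv ℝ n (fun y ↦ A.bilin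 y - Kerr.bilin M 0 y) x.1‖ ≤ C / (A.radius x.1) ^ (n + 2)) → (∃ R₈ L₈ : ℝ, ∀ x ∈ (Kerr.exterior M a : Set E4), R₈ ≤ Kerr.radius a x → |A.radius (Θ x) - Kerr.radius a x| ≤ L₈) → ∃ R₉ C₉ : ℝ, ∀ x ∈ (Kerr.exterior M a : Set E4), R₉ ≤ Kerr.radius a x → ∀ v : E3, ‖v‖ ≤ 1 → |fderiv ℝ Θ x (E4.ofTimeSpace 0 v) 0| ≤ C₉ / (Kerr.radius a x * Real.sqrt (Kerr.radius a x))) → (∀ (𝓑 : StationaryAFBlackHole.{0}) (A : 𝓑.AdaptedChart) (M a c : ℝ) (Θ : E4 → E4), ChartIsAsymptoticallyCartesian A → ChartIsAsymptoticallySchwarzschildean' A → Kerr.IsSubextremal M a → 0 < c → ContDiffOn ℝ ∞ Θ (Kerr.exterior M a : Set E4) → Set.InjOn Θ (Kerr.exterior M a : Set E4) → Set.MapsTo Θ (Kerr.exterior M a : Set E4) (A.domain : Set E4) → (∀ x ∈ (Kerr.exterior M a : Set E4), ∀ s : ℝ, Θ (x + s • E4.basisVector 0) = Θ x + (c * s)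 • E4.basisVector 0) → (∀ x ∈ (Kerr.exterior M a : Set E4), ∀ v w : E4, A.bilin (Θ x) (fderiv ℝ Θ x v) (fderiv ℝ Θ x w) = Kerr.bilin M a x v w) → Θ '' (Kerr.exterior M a : Set E4) = {u : E4 | ∃ h : u ∈ A.domain, A.toFun ⟨u, h⟩ ∈ 𝓑.doc} → (∀ R₁ : ℝ, ∃ R : ℝ, ∀ x ∈ (Kerr.exterior M a : Set E4), R ≤ Kerr.radius a x → R₁ ≤ A.radius (Θ x)) → c = 1 → (∃ R₉ C₉ : ℝ, ∀ x ∈ (Kerr.exterior M a : Set E4), R₉ ≤ Kerr.radius a x → ∀ v : E3, ‖v‖ ≤ 1 → |fderiv ℝ Θ x (E4.ofTimeSpace 0 v) 0| ≤ C₉ / (Kerr.radius a x * Real.sqrt (Kerr.radius a x))) → ∃ R L : ℝ, ∀ u ∈ (Kerr.exterior M a : Set E4), R ≤ Kerr.radius a u → |Θ u 0 - c * u 0| ≤ L) → (∀ (𝓑 : StationaryAFBlackHole.{0}) (A : 𝓑.AdaptedChart) (M a c : ℝ) (Θ : E4 → E4), ChartIsAsymptoticallyCartesian A → ChartIsAsymptoticallySchwarzschildean'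 A → Kerr.IsSubextremal M a → 0 < c → ContDiffOn ℝ ∞ Θ (Kerr.exterior M a : Set E4) → Set.InjOn Θ (Kerr.exterior M a : Set E4) → Set.MapsTo Θ (Kerr.exterior M a : Set E4) (A.domain : Set E4) → (∀ x ∈ (Kerr.exterior M a : Set E4), ∀ s : ℝ, Θ (x + s • E4.basisVector 0) = Θ x + (c * s) • E4.basisVector 0) → (∀ x ∈ (Kerr.exterior M a : Set E4), ∀ v w : E4, A.bilin (Θ x) (fderiv ℝ Θ x v) (fderiv ℝ Θ x w) = Kerr.bilin M a x v w) → Θ '' (Kerr.exterior M a : Set E4) = {u : E4 | ∃ h : u ∈ A.domain, A.toFun ⟨u, h⟩ ∈ 𝓑.doc} → (∀ R₁ : ℝ, ∃ R : ℝ, ∀ x ∈ (Kerr.exterior M a : Set E4), R ≤ Kerr.radius a x → R₁ ≤ A.radius (Θ x)) → c = 1 → ∀ R L : ℝ, (∀ u ∈ (Kerr.exterior M a : Set E4), R ≤ Kerr.radius a u → ‖fderiv ℝ Θ u‖ ≤ L ∧ ∀ v : E4, ‖v‖ ≤ L * ‖fderiv ℝ Θ u v‖) → (∃ R' L₂ :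 ℝ, ∀ u ∈ (Kerr.exterior M a : Set E4), R' ≤ Kerr.radius a u → ‖iteratedFDeriv ℝ 2 Θ u‖ ≤ L₂) → ∃ R₃ L₃ : ℝ, ∀ u ∈ (Kerr.exterior M a : Set E4), R₃ ≤ Kerr.radius a u → ‖iteratedFDeriv ℝ 3 Θ u‖ ≤ L₃) → KerrAsymptoticRigidity := by
  intro h1 h2 h3 h4 h5 h6 h7 h8 h9 h10 h11 h12 h13 𝓑 A M a c Θ hAC hAS hMa hc hΘs hΘi hΘm hΘT hΘiso hanch hfar
  -- layer 1: the time-translation rate is `c = 1`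
  have hc1 : c = 1 := h1 𝓑 A M a c Θ hAC hAS hMa hc hΘs hΘi hΘm hΘT hΘiso hanch hfar
  -- layer 2: two-sided first-derivative bounds far out
  obtain ⟨R, L, hRL⟩ := h2 𝓑 A M a c Θ hAC hAS hMa hc hΘs hΘi hΘm hΘT hΘiso hanch hfar
  -- layer 4: the explicit second-derivative bound
  have l4 := h4 𝓑 A M a c Θ hAC hAS hMa hc hΘs hΘi hΘm hΘT hΘiso hanch hfar R L hRL
  -- layer 5: bounded second derivative
  obtain ⟨R₂, L₂, hL₂⟩ := h5 𝓑 A M a c Θ hAC hAS hMa hc hΘs hΘi hΘm hΘT hΘiso hanch hfar R L hRL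
  -- layer 6: the two radii are comparable
  have l6 := h6 𝓑 A M a c Θ hAC hAS hMa hc hΘs hΘi hΘm hΘT hΘiso hanch hfar hc1 R L hRL
  -- layer 7: `‖D²Θ‖ ≤ C₅ / r²`
  have l7 := h7 𝓑 A M a c Θ hAC hAS hMa hc hΘs hΘi hΘm hΘT hΘiso hanch hfar R L hRL l4 l6
  -- layer 8: the asymptotic Lorentz map `Λ`
  obtain ⟨Λ, hΛe, hΛη, R₆, C₆, hΛ⟩ := h8 𝓑 A M a c Θ hAC hAS hMa hc hΘs hΘi hΘm hΘT hΘiso hanch hfar l7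
  -- layer 9: `O(√r)` drift
  obtain ⟨R₇, C₇, hdrift⟩ := h9 𝓑 A M a c Θ hAC hAS hMa hc hΘs hΘi hΘm hΘT hΘiso hanch hfar Λ R₆ C₆ hΛe hΛ
  -- layer 10: mass agreement and bounded radial distortion
  obtain ⟨hmass, R₈, L₈, hrad⟩ :=
    h10 𝓑 A M a c Θ hAC hAS hMa hc hΘs hΘi hΘm hΘT hΘiso hanch hfar hc1 Λ R₇ C₇ hΛe hΛη hdrift l6
  -- layer 11: the tilt has derivative `O(r^{-3/2})` along the slices
  have l11 := h11 𝓑 A M a c Θ hAC hAS hMa hc hΘs hΘi hΘm hΘT hΘiso hanch hfar hc1 Λ R₆ C₆ R₇ C₇ hΛe hΛη hΛ hdrift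
    hmass ⟨R₈, L₈, hrad⟩
  -- layer 12: bounded tilt
  obtain ⟨Rt, Lt, htilt⟩ := h12 𝓑 A M a c Θ hAC hAS hMa hc hΘs hΘi hΘm hΘT hΘiso hanch hfar hc1 l11
  -- layer 13: bounded third derivative
  obtain ⟨R₃, L₃, hD3⟩ := h13 𝓑 A M a c Θ hAC hAS hMa hc hΘs hΘi hΘm hΘT hΘiso hanch hfar hc1 R L hRL ⟨R₂, L₂, hL₂⟩
  -- layer 3: from the far-out bounds (at the maximum of the thresholds and of the bounds) to `{r ≥ r₊ + 1}`
  refine h3 𝓑 A M a c Θ hAC hAS hMa hc hΘs hΘi hΘm hΘT hΘiso hanch hfar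
    ⟨max (max (max Rt R₈) (max R R₂)) R₃, max (max (max Lt L₈) (max L L₂)) L₃, fun u hu hRu ↦ ?_⟩
  simp only [max_le_iff] at hRu
  obtain ⟨⟨⟨hRt, hR₈⟩, hR, hR₂⟩, hR₃⟩ := hRu
  have eLt : Lt ≤ max (max (max Lt L₈) (max L L₂)) L₃ :=
    ((le_max_left _ _).trans (le_max_left _ _)).trans (le_max_left _ _)
  have eL₈ : L₈ ≤ max (max (max Lt L₈) (max L L₂)) L₃ :=
    ((le_max_right _ _).trans (le_max_left _ _)).trans (le_max_left _ _)
  have eL : L ≤ max (max (max Lt L₈) (max L L₂)) L₃ :=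
    ((le_max_left _ _).trans (le_max_right _ _)).trans (le_max_left _ _)
  have eL₂ : L₂ ≤ max (max (max Lt L₈) (max L L₂)) L₃ :=
    ((le_max_right _ _).trans (le_max_right _ _)).trans (le_max_left _ _)
  have eL₃ : L₃ ≤ max (max (max Lt L₈) (max L L₂)) L₃ := le_max_right _ _
  refine ⟨(htilt u hu hRt).trans eLt, (hrad u hu hR₈).trans eL₈, fun n h1n hn3 ↦ ?_⟩
  interval_cases n
  · -- `n = 1`: `‖iteratedFDeriv ℝ 1 Θ u‖ = ‖fderiv ℝ Θ u‖ ≤ L`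
    rw [← norm_iteratedFDeriv_fderiv, norm_iteratedFDeriv_zero]
    exact (hRL u hu hR).1.trans eL
  · -- `n = 2`
    exact (hL₂ u hu hR₂).trans eL₂
  · -- `n = 3`
    exact (hD3 u hu hR₃).trans eL₃

/-- **F4 · asymptotic rigidity at `i⁰` holds** (registered closer of stub `stub_kerrAsymptoticRigidity`): the assembly
`kerrAsymptoticRigidity_of_layers` applied to the thirteen landed layer theorems. [folklore] -/
theorem kerrAsymptoticRigidity_holds : KerrAsymptoticRigidity := kerrAsymptoticRigidity_of_layers kerrAsymptoticRigidity_c_eq_one kerrAsymptoticRigidity_fderiv_bounded kerrAsymptoticRigidity_of_far kerrAsymptoticRigidity_iteratedFDeriv_two_le kerrAsymptoticRigidity_iteratedFDeriv_two_bounded kerrAsymptoticRigidity_radius_comparable kerrAsymptoticRigidity_iteratedFDeriv_two_decay kerrAsymptoticRigidity_fderiv_limit kerrAsymptoticRigidity_drift kerrAsymptoticRigidity_mass_and_radius kerrAsymptoticRigidity_tilt_fderiv kerrAsymptoticRigidity_tilt_bounded kerrAsymptoticRigidity_iteratedFDeriv_three_bounded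

end Summit.FinalStateConjecture.FinalStateConjecture.Theorems.SymplecticDualOfTheBomb
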